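import Summits.QuantumFields.YangMills.Theorems.UV3PinnedStepThroughOfMassEnvelope
import HarnessLib

/-!
# R3 (cell `ym3-torus`, YM₃ on T³ — a ladder RUNG, NOT d = 4, NOT the Clay problem) — **R-19936-S: THE ORGAN ROW (S-ii) `hSii` OF `stub_pinnedStep` IS A THEOREM
# MODULO ONE DISPLAYED ROW hJ, THE TOP-LEVEL A.E. MASS ENVELOPE OF THE K-FOLD TRANSPORTED HISTORY MASSES** (★★OWNER WORD 58 residual-designate of R-19936-S∕U)

Seat `ym-ust-19936-w6` g7 (R526 (S) hand; LOCATE `LOCATE-S-ORGAN-w6g7.md` 6114e073, 19936 evidence #60, row T6).  THEOREMS ONLY (0 `def`, 0 `sorry`);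
`--supports stmt-QuantumFields-19936 --as helper`; count-neutral; CONDITIONAL on the v1 (α) socket `AlphaInputsT3AC.Of F 𝔠` and on hJ.

THE CHAIN BY KERNEL AFTER THIS FILE (v1 currency): `stub_pinnedStep` (v3 text, skeleton de3325bf) ⟸ ✓p749772 `UV3PinnedStepV3FaceOfPackage` `(hpkg)(π)(hMain)(hPinA)` ⟸ ✓p750864
`UV3PinnedStepKnitOfPackage.hPinA_of_pinnedLF (π) (hSii)` ⟸ ✓p749282 BRICK C ∧ **`hSii` = §3 `AlphaInputsT3AC.Of.hSii_of_massEnvelope (hJ)`** — so R-19936-S displays, beyond the socket and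
the EX-lane row `hMain`, EXACTLY hJ.

hJ (the displayed row; WORD 58 letter (a) a.e., (b) K-uniform and restricted to admissible non-trivial histories, (c) `A₀ = 0` tonight — FILE 1 carries the `A₀` slot, the twin
`m ≤ exp(A₁ + A₀·Σ_j|Z_j|)` with `8(A+A₀)K_c³∕ℓ ≤ c₁b₀²` is a later letter —, (d)): `∃ A₁, ∀ K (r : Hist (F.P K) K), Admissible r → r ≠ triv → ∀ᵐ W ∂dV_K, m_K(r, W) ≤ exp A₁` for the
lane's masses `m = (inputOfAC 𝔠.lane p.X p.𝔖).W.mass = MassesAC.massRecAC` (exact Radon–Nikodym transports of the step weights along `blockAvg ℰp`).  WHY TRUE IN PRINT ∕ WHY OPEN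
HERE: in [Balaban1985UV3] (41) the masses are the integrals «∫dV↾Z δ(V̄V⁻¹)⋯χ⋯ ≤ 1» because print's averaging is Haar-compatible; the tree's `blockAvg ℰp` is only absolutely
continuous (`T_k 1 ≠ 1`, lit `AveragingImageLawGaugeInvariance`; forests are exact Haar, `BalabanUVNodesN08HaarCompatibilityForests`; the loop part is the content) — the k-fold
Jacobian row, lit GAPS G-B10-10(c) = `B10LargeFieldSum.HistModel.dominated`'s slot, `Thm2AC` «located-unprinted».

CONTENTS (at `p : AlphaInputsT3AC.PkgAt F 𝔠 γ hγ hγ1 K`, `S = T3Scales F γ …`, `Kc = 𝔠.lane.carrier`; the per-candidate bound is the prequel ✓`UV3PinnedStepThroughOfMassEnvelope.through_le_of_massEnvelope`):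
`pFun_sq_eq` (rate letters); ★ `restricted_sum_le_through_sums` (the pinned family is covered by «through `(j,a)`» and «through a collar candidate» — FILE 2
✓`exists_near_of_not_plaqCover_subset_Omega`); ★ `collar_scaleSum_le_at` (the collar branch summed down the scales, FILE 2 ✓`scaleSum_collar_le` with the prequel's `near_count_real_le`;
`κ = c₁b₀²∕8 ≥ 7` by ✓`prov_hb₂`, `3r₀ + 2 ≤ 2p₀` by ✓`prov_hp`); ★★★ `pinnedLF_le_of_massEnvelope` (per `(K, j, a, W)` under the envelope: the restricted sum of `hSii` is
`≤ exp(A₁ + (3∕ℓ)(2L^m)³ + log(1 + C_coll∕ℓ))·exp(−(c₁∕16)·p(g_j)²)`); ★★★ `AlphaInputsT3AC.Of.hSii_of_massEnvelope` — ✓p750864's `hSii` binder VERBATIM from hJ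
(`A := 0`, `c := c₁∕16 = 1∕128`, `CZ := A₁ + (6∕log L)(2L^m)³ + log(1 + C_coll∕ℓ)`; the finitely many a.e. envelopes gathered by `ae_all_iff`).

HONEST SCOPE.  Bookkeeping over the socket's rows, the lane's geometry and FILEs 1, 2, 3a; hJ is DISPLAYED, not proved; nothing of `stub_pinnedStep`, `stub_unitEnvelope`, `hP′`,
`HistoryTailL` (19936), the rung, d = 4, a mass gap or Clay is proved here; no summit statement is proved by this seat.

References: T. Bałaban, Commun. Math. Phys. **102** (1985) 255–275 [Balaban1985UV3] ((38)–(41) p. 266, (67)–(71) p. 273, pp. 273–274, (7) p. 257, (5) p. 256).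
-/

set_option autoImplicit false

noncomputable section

namespace Summit.QuantumFields.YangMills.Theorems.UV3PinnedStepOrganOfMassEnvelope

open MeasureTheory
open scoped BigOperators
open Literature.MathematicalPhysics.QuantumFieldTheory.Balaban1983to89
open Literature.MathematicalPhysics.QuantumFieldTheory.Balaban1983to89.B10LargeField (xlog one_le_xlog pFun_eq xlog_gRun)
open Literature.MathematicalPhysics.QuantumFieldTheory.Balaban1983to89.T3ContinuumYM3Torus
open Literature.MathematicalPhysics.QuantumFieldTheory.Balaban1983to89.T3UnitLawDensityEML (ℰp)
open Literature.MathematicalPhysics.QuantumFieldTheory.Balaban1985CMP102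
open Literature.MathematicalPhysics.QuantumFieldTheory.Balaban1985CMP102.Setting
open Summit.QuantumFields.Balaban3D.Carriers
open Summit.QuantumFields.Balaban3D.Proofs.Primitives
open Summit.QuantumFields.Balaban3D.Proofs.ScalesArithmetic (gk_pos gk_le_one g0sq_pos gk_eq_gRun_norm)
open Summit.QuantumFields.Balaban3D.Proofs.Family (prov_hb₁ prov_hb₂ prov_hp)
open Summit.QuantumFields.Balaban3D.Proofs.TowerAC
open Summit.QuantumFields.Balaban3D.Proofs.StandardAC
open Summit.QuantumFields.Balaban3D.Proofs.InputsAC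
open Summit.QuantumFields.Balaban3D.Proofs.MassesAC (massRecAC_nonneg)
open Summit.QuantumFields.Balaban3D.Proofs.HistCount (card_filter_allCodes_le_exp)
open Summit.QuantumFields.Balaban3D.Proofs.LargeFieldStd (rcolOf_antitone rcolOf_le zcoefOf_le zcoefOf_nonneg)
open Summit.QuantumFields.YangMills.Theorems.UV3LargeFieldEnvelopedResummation (largeField_enveloped_adm)
open Summit.QuantumFields.YangMills.Theorems.UV3PinnedCollarBranch
open Summit.QuantumFields.YangMills.Theorems.UV3PinnedStepThroughOfMassEnvelope

variable {F : T3Family} {𝔠 : AlphaConsts F.L (suGroupModel 2).N} {γ : ℝ} {hγ : 0 < γ} {hγ1 : γ ≤ (min 𝔠.gamma0 1) ^ 2} {K : ℕ}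
  (p : AlphaInputsT3AC.PkgAt F 𝔠 γ hγ hγ1 K)

/-! ## §1 The restricted sum of `hSii`: pure pin + collar branch -/

/-- `(c₁∕8)·p_{b₀,p₀}(g)² = (c₁b₀²∕8)·x(g)^{2p₀}` and `(c₁∕16)·p(g)² = (c₁b₀²∕16)·x(g)^{2p₀}` for `0 < g ≤ 1` (`p(g) = b₀x(g)^{p₀}`, `x(g) ≥ 1`). [cite: Balaban1985UV3, (7) p.257] -/
theorem pFun_sq_eq {c₁ b₀ p₀ g : ℝ} (hg : 0 < g) (hg1 : g ≤ 1) :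
    B10.pFun b₀ p₀ g ^ 2 = b₀ ^ 2 * xlog g ^ (2 * p₀) ∧
      (c₁ / 8 * B10.pFun b₀ p₀ g ^ 2 = c₁ * b₀ ^ 2 / 8 * xlog g ^ (2 * p₀)) ∧
      (c₁ / 16 * B10.pFun b₀ p₀ g ^ 2 = c₁ * b₀ ^ 2 / 8 / 2 * xlog g ^ (2 * p₀)) := by
  have hx0 : 0 ≤ xlog g := le_trans zero_le_one (one_le_xlog hg hg1)
  have h2 : (xlog g ^ p₀) ^ 2 = xlog g ^ (2 * p₀) := by rw [mul_comm, Real.rpow_mul hx0, Real.rpow_two]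
  have h1 : B10.pFun b₀ p₀ g ^ 2 = b₀ ^ 2 * xlog g ^ (2 * p₀) := by rw [pFun_eq, mul_pow, h2]
  exact ⟨h1, by rw [h1]; ring, by rw [h1]; ring⟩

open Classical in
/-- **THE PINNED FAMILY IS COVERED BY «THROUGH `(j,a)`» AND «THROUGH A COLLAR CANDIDATE»** (sums of a non-negative `f`): for `1 ≤ j < K` and a level-`j` plaquette `a`,
`Σ_{r : a ∈ P_j(r) ∨ ¬ plaqCover a ⊆ Ω_j(r↾j)} f(r) ≤ Σ_{r ∋ (j,a)} f(r) + Σ_{i<j} Σ_{q near a at scale i} Σ_{r ∋ (i,q)} f(r)` — the second disjunct by FILE 2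
✓`exists_near_of_not_plaqCover_subset_Omega` (the plaquette found is recorded in `r`, hence a candidate through which `r` passes). [cite: Balaban1985UV3, (38)–(41) p.266] -/
theorem restricted_sum_le_through_sums {j : ℕ} (hjK : j < K) (a : Plaq (F.P K) j) (f : Hist (F.P K) K → ℝ) (hf0 : ∀ r, 0 ≤ f r) :
    ∑ r ∈ (Finset.univ : Finset (Hist (F.P K) K)).filter (fun r : Hist (F.P K) K =>
        a ∈ r ⟨j, hjK⟩ ∨ ¬ plaqCover a ⊆ Omega 𝔠.lane.carrier.M₁
          (rcolOf (T3Scales F γ hγ (hγ1.trans (sq_min_one_le _ 𝔠.gamma0_pos)) K) 𝔠.lane.carrier) j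
          (fun i : Fin j => r (Fin.castLE hjK.le i)) j), f r ≤
      (∑ r ∈ (Finset.univ : Finset (Hist (F.P K) K)).filter (fun r => ((j : ℕ), plaqCode a) ∈ Hist.disc r), f r) +
      ∑ i ∈ Finset.range j, ∑ q ∈ (Finset.univ : Finset (Plaq (F.P K) i)).filter (fun q => ∃ c ∈ plaqCover q, ∃ y ∈ plaqCover a,
          sdist (j - 1) c y ≤ 2 * (rcolOf (T3Scales F γ hγ (hγ1.trans (sq_min_one_le _ 𝔠.gamma0_pos)) K) 𝔠.lane.carrier i +
            ((F.P K).L * ((F.P K).d * (𝔠.lane.carrier.M₁ - 1)) + (F.P K).d * ((F.P K).L - 1)) + (F.P K).d) + 1),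
        ∑ r ∈ (Finset.univ : Finset (Hist (F.P K) K)).filter (fun r => ((i : ℕ), plaqCode q) ∈ Hist.disc r), f r := by
  set S := T3Scales F γ hγ (hγ1.trans (sq_min_one_le _ 𝔠.gamma0_pos)) K with hS
  set M₁ := 𝔠.lane.carrier.M₁ with hM₁
  set Rcol := rcolOf S 𝔠.lane.carrier with hRcol
  have hSK : S.K = K := rfl
  have hLP : 2 ≤ S.P.L := F.hL.2
  have hjP : j ≤ S.P.m + S.P.K := by show j ≤ F.m + K; omega
  have hR₁ : 0 ≤ 𝔠.lane.carrier.R₁ := 𝔠.R₁_nonneg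
  have hr₀ : 0 ≤ 𝔠.lane.carrier.r₀ := le_trans zero_le_one 𝔠.one_le_r₀
  have hM : 0 < 𝔠.lane.carrier.M₁ := 𝔠.lane.F.M₁_pos
  set ϱ : ℕ → ℕ := fun i => 2 * (Rcol i + (S.P.L * (S.P.d * (M₁ - 1)) + S.P.d * (S.P.L - 1)) + S.P.d) + 1 with hϱ
  set NF : (i : ℕ) → Finset (Plaq (F.P K) i) := fun i => (Finset.univ : Finset (Plaq (F.P K) i)).filter
    (fun q => ∃ c ∈ plaqCover q, ∃ y ∈ plaqCover a, sdist (j - 1) c y ≤ ϱ i) with hNF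
  set e₀ : ℕ × PlaqCode (F.P K) := ((j : ℕ), plaqCode a) with he₀
  set t : ℕ × PlaqCode (F.P K) → Hist (F.P K) K → ℝ := fun e r => if e ∈ Hist.disc r then f r else 0 with ht
  have ht0 : ∀ e r, 0 ≤ t e r := fun e r => by
    show 0 ≤ (if e ∈ Hist.disc r then f r else 0)
    split_ifs
    · exact hf0 r
    · exact le_rfl
  have htsum : ∀ e, ∑ r, t e r = ∑ r ∈ (Finset.univ : Finset (Hist (F.P K) K)).filter (fun r => e ∈ Hist.disc r), f r :=
    fun e => (Finset.sum_filter _ _).symm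
  set g : Hist (F.P K) K → ℝ := fun r => t e₀ r + ∑ i ∈ Finset.range j, ∑ q ∈ NF i, t ((i : ℕ), plaqCode q) r with hgdef
  have hg0 : ∀ r, 0 ≤ g r := fun r =>
    add_nonneg (ht0 e₀ r) (Finset.sum_nonneg fun i _ => Finset.sum_nonneg fun q _ => ht0 _ r)
  -- pointwise domination on the family
  have hdom : ∀ r ∈ (Finset.univ : Finset (Hist (F.P K) K)).filter (fun r : Hist (F.P K) K =>
      a ∈ r ⟨j, hjK⟩ ∨ ¬ plaqCover a ⊆ Omega M₁ Rcol j (fun i : Fin j => r (Fin.castLE hjK.le i)) j), f r ≤ g r := by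
    intro r hrH
    obtain ⟨-, hrH⟩ := Finset.mem_filter.mp hrH
    have hsum0 : 0 ≤ ∑ i ∈ Finset.range j, ∑ q ∈ NF i, t ((i : ℕ), plaqCode q) r :=
      Finset.sum_nonneg fun i _ => Finset.sum_nonneg fun q _ => ht0 _ r
    rcases hrH with ha | hna
    · have hmem : e₀ ∈ Hist.disc r := (Hist.mem_disc r e₀).2 ⟨⟨j, hjK⟩, a, ha, rfl⟩
      have h1 : t e₀ r = f r := by show (if e₀ ∈ Hist.disc r then f r else 0) = f r; rw [if_pos hmem]
      show f r ≤ t e₀ r + _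
      linarith
    · obtain ⟨i, hi, q, hq, c, hc, y, hy, hd⟩ := exists_near_of_not_plaqCover_subset_Omega M₁ Rcol hM
        (rcolOf_antitone (S := S) 𝔠.lane.carrier hR₁ hr₀) hLP hjP (by rw [hSK]; exact hjK.le)
        (fun i : Fin j => r (Fin.castLE hjK.le i)) a hna
      have hmem : ((i : ℕ), plaqCode q) ∈ Hist.disc r := (Hist.mem_disc r _).2 ⟨⟨i, hi.trans hjK⟩, q, hq, rfl⟩
      have hqN : q ∈ NF i := Finset.mem_filter.mpr ⟨Finset.mem_univ _, c, hc, y, hy, hd⟩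
      have h0 : t ((i : ℕ), plaqCode q) r = f r := by
        show (if ((i : ℕ), plaqCode q) ∈ Hist.disc r then f r else 0) = f r; rw [if_pos hmem]
      have h1 : t ((i : ℕ), plaqCode q) r ≤ ∑ q' ∈ NF i, t ((i : ℕ), plaqCode q') r :=
        Finset.single_le_sum (f := fun q' => t ((i : ℕ), plaqCode q') r) (fun q' _ => ht0 _ r) hqN
      have h2 : ∑ q' ∈ NF i, t ((i : ℕ), plaqCode q') r ≤
          ∑ i' ∈ Finset.range j, ∑ q' ∈ NF i', t ((i' : ℕ), plaqCode q') r :=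
        Finset.single_le_sum (f := fun i' => ∑ q' ∈ NF i', t ((i' : ℕ), plaqCode q') r)
          (fun i' _ => Finset.sum_nonneg fun q' _ => ht0 _ r) (Finset.mem_range.mpr hi)
      have h3 := ht0 e₀ r
      show f r ≤ t e₀ r + _
      linarith
  calc ∑ r ∈ (Finset.univ : Finset (Hist (F.P K) K)).filter (fun r : Hist (F.P K) K =>
        a ∈ r ⟨j, hjK⟩ ∨ ¬ plaqCover a ⊆ Omega M₁ Rcol j (fun i : Fin j => r (Fin.castLE hjK.le i)) j), f r
      ≤ ∑ r ∈ (Finset.univ : Finset (Hist (F.P K) K)).filter (fun r : Hist (F.P K) K =>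
        a ∈ r ⟨j, hjK⟩ ∨ ¬ plaqCover a ⊆ Omega M₁ Rcol j (fun i : Fin j => r (Fin.castLE hjK.le i)) j), g r :=
        Finset.sum_le_sum hdom
    _ ≤ ∑ r, g r := Finset.sum_le_univ_sum_of_nonneg hg0
    _ = ∑ r, t e₀ r + ∑ i ∈ Finset.range j, ∑ q ∈ NF i, ∑ r, t ((i : ℕ), plaqCode q) r := by
        rw [hgdef, Finset.sum_add_distrib, Finset.sum_comm]
        congr 1
        exact Finset.sum_congr rfl fun i _ => Finset.sum_comm
    _ = _ := by
        rw [htsum]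
        congr 1
        exact Finset.sum_congr rfl fun i _ => Finset.sum_congr rfl fun q _ => htsum _

open Classical in
/-- **THE COLLAR BRANCH SUMMED DOWN THE SCALES, AT THE PACKAGE**: for `1 ≤ j < K`, `Σ_{i<j} #{q : Plaq i near a}·exp(−κ·x(g_i)^{2p₀}) ≤ (C_coll∕ℓ)·exp(−(κ∕2)·x(g_j)^{2p₀})`, `κ = c₁b₀²∕8`
(FILE 2 ✓`scaleSum_collar_le` with the counts of the prequel's `near_count_real_le`; `κ ≥ 7` by ✓`prov_hb₂`, `3r₀ + 2 ≤ 2p₀` by ✓`prov_hp`, the progression by `xlog_gRun`). [cite: Balaban1985UV3, pp.273–274, (7) p.257] -/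
theorem collar_scaleSum_le_at {j : ℕ} (hjK : j < K) (a : Plaq (F.P K) j) :
    ∑ i ∈ Finset.range j, ((((Finset.univ : Finset (Plaq (F.P K) i)).filter (fun q => ∃ c ∈ plaqCover q, ∃ y ∈ plaqCover a,
          sdist (j - 1) c y ≤ 2 * (rcolOf (T3Scales F γ hγ (hγ1.trans (sq_min_one_le _ 𝔠.gamma0_pos)) K) 𝔠.lane.carrier i +
            ((F.P K).L * ((F.P K).d * (𝔠.lane.carrier.M₁ - 1)) + (F.P K).d * ((F.P K).L - 1)) + (F.P K).d) + 1)).card : ℕ) : ℝ) *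
        Real.exp (-(1 / (4 * ((suGroupModel 2).N : ℝ)) * 𝔠.lane.carrier.b₀ ^ 2 / 8 *
          xlog ((T3Scales F γ hγ (hγ1.trans (sq_min_one_le _ 𝔠.gamma0_pos)) K).gk i) ^ (2 * 𝔠.lane.carrier.p₀))) ≤
      9 * (2 * (2 * ((𝔠.lane.carrier.R₁ + 1) * 𝔠.lane.carrier.M₁) +
          2 * ((F.L : ℝ) * (3 * ((𝔠.lane.carrier.M₁ : ℝ) - 1)) + 3 * ((F.L : ℝ) - 1)) + 15 * F.L + 7) + 6) ^ 3 / (Real.log F.L / 2) *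
        Real.exp (-(1 / (4 * ((suGroupModel 2).N : ℝ)) * 𝔠.lane.carrier.b₀ ^ 2 / 8 / 2 *
          xlog ((T3Scales F γ hγ (hγ1.trans (sq_min_one_le _ 𝔠.gamma0_pos)) K).gk j) ^ (2 * 𝔠.lane.carrier.p₀))) := by
  set S := T3Scales F γ hγ (hγ1.trans (sq_min_one_le _ 𝔠.gamma0_pos)) K with hS
  have hSK : S.K = K := rfl
  have hL : 2 ≤ F.L := F.hL.2
  have hLr : (2 : ℝ) ≤ F.L := by exact_mod_cast hL
  have hR₁ : 0 ≤ 𝔠.lane.carrier.R₁ := 𝔠.R₁_nonneg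
  have hr : 0 ≤ 𝔠.lane.carrier.r₀ := le_trans zero_le_one 𝔠.one_le_r₀
  have hM : 0 < 𝔠.lane.carrier.M₁ := 𝔠.lane.F.M₁_pos
  have hMr : (1 : ℝ) ≤ 𝔠.lane.carrier.M₁ := by exact_mod_cast hM
  have hNpos : 0 < (suGroupModel 2).N := (suGroupModel 2).N_pos
  have hlogL : 0 < Real.log F.L := Real.log_pos (by linarith)
  have hg : ∀ i, i ≤ K → 0 < S.gk i ∧ S.gk i ≤ 1 := fun i hi => ⟨gk_pos S i, gk_le_one S S.gK_le_one i hi⟩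
  have hC0 : (0 : ℝ) ≤ 9 * (2 * (2 * ((𝔠.lane.carrier.R₁ + 1) * 𝔠.lane.carrier.M₁) +
      2 * ((F.L : ℝ) * (3 * ((𝔠.lane.carrier.M₁ : ℝ) - 1)) + 3 * ((F.L : ℝ) - 1)) + 15 * F.L + 7) + 6) ^ 3 := by
    have h1 : (0 : ℝ) ≤ (𝔠.lane.carrier.R₁ + 1) * 𝔠.lane.carrier.M₁ := by positivity
    have h2 : (0 : ℝ) ≤ (F.L : ℝ) * (3 * ((𝔠.lane.carrier.M₁ : ℝ) - 1)) := by nlinarith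
    exact mul_nonneg (by norm_num) (pow_nonneg (by nlinarith) 3)
  have hx : ∀ i, i ≤ K → xlog (S.gk i) = xlog (S.gk K) + ((K - i : ℕ) : ℝ) * (Real.log F.L / 2) := by
    intro i hi
    rw [gk_eq_gRun_norm S i, gk_eq_gRun_norm S K]
    exact xlog_gRun 1 (F.L : ℝ) S.g0sq one_pos (by linarith) (g0sq_pos S) hi
  have hdiff : ∀ i, i ≤ j → xlog (S.gk i) - xlog (S.gk j) = ((j - i : ℕ) : ℝ) * (Real.log F.L / 2) := by
    intro i hi
    rw [hx i (hi.trans hjK.le), hx j hjK.le]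
    have : ((K - i : ℕ) : ℝ) = ((K - j : ℕ) : ℝ) + ((j - i : ℕ) : ℝ) := by
      rw [← Nat.cast_add]; congr 1; omega
    rw [this]; ring
  have hxj : 1 ≤ xlog (S.gk j) := one_le_xlog (hg j hjK.le).1 (hg j hjK.le).2
  have hb₂ := prov_hb₂ 𝔠 hNpos
  have hκ7 : 7 ≤ 1 / (4 * ((suGroupModel 2).N : ℝ)) * 𝔠.lane.carrier.b₀ ^ 2 / 8 := by linarith
  have hp := prov_hp 𝔠
  refine scaleSum_collar_le (x := fun i => xlog (S.gk i)) (σ := 3 * Real.log F.L) (q := 3 * 𝔠.lane.carrier.r₀) (s := 2 * 𝔠.lane.carrier.p₀)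
    _ hC0 (by positivity) (by positivity) (by linarith) (by nlinarith) (by positivity) (by linarith) hxj hdiff ?_
  intro i hi
  exact near_count_real_le (S := S) 𝔠.lane.carrier hL hM hR₁ hr hi (by rw [hSK]; exact hjK.le) a

set_option maxHeartbeats 400000 in
open Classical in
/-- ★★★ **THE RESTRICTED SUM OF (S-ii), `dV_K`-POINTWISE UNDER THE ENVELOPE**: at the package's data, for `1 ≤ j < K`, a level-`j` plaquette `a` and a unit-lattice field `W` at which every
admissible non-trivial history has mass `≤ e^{A₁}`, the (41)_K history sum RESTRICTED to «`a ∈ P_j(r)` ∨ `¬ plaqCover a ⊆ Ω_j(r↾j)`» is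
`≤ exp(A₁ + (3∕ℓ)(2L^m)³ + log(1 + C_coll∕ℓ))·exp(−(c₁∕16)·p(g_j)²)`, `g_j = √(γL^{−(K−j)})`, `c₁ = 1∕(4N)`: the domination `restricted_sum_le_through_sums`, the prequel per candidate
(`through_le_of_massEnvelope`), the collar scale sum `collar_scaleSum_le_at`. [cite: Balaban1985UV3, (38)–(41) p.266, (67)–(71) p.273, pp.273–274] -/
theorem pinnedLF_le_of_massEnvelope {A₁ : ℝ} {j : ℕ} (hjK : j < K) (a : Plaq (F.P K) j)
    (W : GaugeField (F.P K) K (Matrix.specialUnitaryGroup (Fin 2) ℂ))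
    (hW : ∀ r : Hist (F.P K) K,
      Hist.Admissible 𝔠.lane.carrier.M₁ (rcolOf (T3Scales F γ hγ (hγ1.trans (sq_min_one_le _ 𝔠.gamma0_pos)) K) 𝔠.lane.carrier) K r →
      r ≠ Hist.triv (F.P K) K → (inputOfAC 𝔠.lane p.X p.𝔖).W.mass K r W ≤ Real.exp A₁) :
    ∑ r ∈ (Finset.univ : Finset (Hist (F.P K) K)).filter (fun r : Hist (F.P K) K =>
        a ∈ r ⟨j, hjK⟩ ∨ ¬ plaqCover a ⊆ Omega 𝔠.lane.carrier.M₁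
          (rcolOf (T3Scales F γ hγ (hγ1.trans (sq_min_one_le _ 𝔠.gamma0_pos)) K) 𝔠.lane.carrier) j
          (fun i : Fin j => r (Fin.castLE hjK.le i)) j),
      (inputOfAC 𝔠.lane p.X p.𝔖).W.mass K r W * Real.exp (-(p.T.mainT K r W) + p.T.Zterm K r) ≤
    Real.exp (A₁ + 3 / (Real.log F.L / 2) * (2 * (F.L : ℝ) ^ F.m) ^ 3 +
        Real.log (1 + 9 * (2 * (2 * ((𝔠.lane.carrier.R₁ + 1) * 𝔠.lane.carrier.M₁) +
          2 * ((F.L : ℝ) * (3 * ((𝔠.lane.carrier.M₁ : ℝ) - 1)) + 3 * ((F.L : ℝ) - 1)) + 15 * F.L + 7) + 6) ^ 3 / (Real.log F.L / 2))) *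
      Real.exp (-(1 / (4 * ((suGroupModel 2).N : ℝ)) / 16 *
        B10.pFun 𝔠.b₀ 𝔠.p₀ (Real.sqrt (γ * ((F.L : ℝ)⁻¹) ^ (K - j))) ^ 2)) := by
  set S := T3Scales F γ hγ (hγ1.trans (sq_min_one_le _ 𝔠.gamma0_pos)) K with hS
  set ℓ : ℝ := Real.log F.L / 2 with hℓdef
  set Sm : ℝ := (2 * (F.L : ℝ) ^ F.m) ^ 3 with hSm
  set c₁ : ℝ := 1 / (4 * ((suGroupModel 2).N : ℝ)) with hc₁def
  set Ccoll : ℝ := 9 * (2 * (2 * ((𝔠.lane.carrier.R₁ + 1) * 𝔠.lane.carrier.M₁) +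
    2 * ((F.L : ℝ) * (3 * ((𝔠.lane.carrier.M₁ : ℝ) - 1)) + 3 * ((F.L : ℝ) - 1)) + 15 * F.L + 7) + 6) ^ 3 with hCcoll
  have hL : 2 ≤ F.L := F.hL.2
  have hLr : (2 : ℝ) ≤ F.L := by exact_mod_cast hL
  have hMr : (1 : ℝ) ≤ 𝔠.lane.carrier.M₁ := by exact_mod_cast 𝔠.lane.F.M₁_pos
  have hc₁0 : 0 ≤ c₁ := by rw [hc₁def]; positivity
  have hlogL : 0 < Real.log F.L := Real.log_pos (by linarith)
  have hℓ : 0 < ℓ := by rw [hℓdef]; positivity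
  have hg : ∀ i, i ≤ K → 0 < S.gk i ∧ S.gk i ≤ 1 := fun i hi => ⟨gk_pos S i, gk_le_one S S.gK_le_one i hi⟩
  have hR₁ : 0 ≤ 𝔠.lane.carrier.R₁ := 𝔠.R₁_nonneg
  have hCcoll0 : 0 ≤ Ccoll := by
    have h1 : (0 : ℝ) ≤ (𝔠.lane.carrier.R₁ + 1) * 𝔠.lane.carrier.M₁ := mul_nonneg (by linarith) (by linarith)
    have h2 : (0 : ℝ) ≤ (F.L : ℝ) * (3 * ((𝔠.lane.carrier.M₁ : ℝ) - 1)) := by nlinarith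
    rw [hCcoll]; exact mul_nonneg (by norm_num) (pow_nonneg (by nlinarith) 3)
  -- the summand, the per-candidate sums, and §2 in `κ·x^{2p₀}` form
  set f : Hist (F.P K) K → ℝ := fun r =>
    (inputOfAC 𝔠.lane p.X p.𝔖).W.mass K r W * Real.exp (-(p.T.mainT K r W) + p.T.Zterm K r) with hf
  have hf0 : ∀ r, 0 ≤ f r := fun r => mul_nonneg ((inputOfAC 𝔠.lane p.X p.𝔖).W.mass_nonneg K r W) (Real.exp_pos _).le
  have hθ : ∀ i, i ≤ K → c₁ / 8 * B10.pFun 𝔠.lane.carrier.b₀ 𝔠.lane.carrier.p₀ (S.gk i) ^ 2 =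
      c₁ * 𝔠.lane.carrier.b₀ ^ 2 / 8 * xlog (S.gk i) ^ (2 * 𝔠.lane.carrier.p₀) :=
    fun i hi => (pFun_sq_eq (c₁ := c₁) (b₀ := 𝔠.lane.carrier.b₀) (p₀ := 𝔠.lane.carrier.p₀) (hg i hi).1 (hg i hi).2).2.1
  have hTle : ∀ e ∈ allCodes (F.P K) K, ∑ r ∈ (Finset.univ : Finset (Hist (F.P K) K)).filter (fun r => e ∈ Hist.disc r), f r ≤
      Real.exp A₁ * Real.exp (-(c₁ * 𝔠.lane.carrier.b₀ ^ 2 / 8 * xlog (S.gk e.1) ^ (2 * 𝔠.lane.carrier.p₀))) * Real.exp (3 / ℓ * Sm) := by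
    intro e he
    have h := through_le_of_massEnvelope p W hW e he
    rw [hθ e.1 (Hist.disc_lt _ e he).le] at h
    exact h
  -- the three pieces
  have hsplit := restricted_sum_le_through_sums (𝔠 := 𝔠) (γ := γ) (hγ := hγ) (hγ1 := hγ1) hjK a f hf0
  have hcollar := collar_scaleSum_le_at (𝔠 := 𝔠) (γ := γ) (hγ := hγ) (hγ1 := hγ1) hjK a
  have he₀E : ((j : ℕ), plaqCode a) ∈ allCodes (F.P K) K := (Hist.mem_disc _ _).2 ⟨⟨j, hjK⟩, a, Finset.mem_univ _, rfl⟩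
  have hpin : ∑ r ∈ (Finset.univ : Finset (Hist (F.P K) K)).filter (fun r => ((j : ℕ), plaqCode a) ∈ Hist.disc r), f r ≤
      Real.exp A₁ * Real.exp (3 / ℓ * Sm) * Real.exp (-(c₁ * 𝔠.lane.carrier.b₀ ^ 2 / 8 / 2 * xlog (S.gk j) ^ (2 * 𝔠.lane.carrier.p₀))) := by
    have h := hTle _ he₀E
    have hmono : Real.exp (-(c₁ * 𝔠.lane.carrier.b₀ ^ 2 / 8 * xlog (S.gk j) ^ (2 * 𝔠.lane.carrier.p₀))) ≤
        Real.exp (-(c₁ * 𝔠.lane.carrier.b₀ ^ 2 / 8 / 2 * xlog (S.gk j) ^ (2 * 𝔠.lane.carrier.p₀))) := by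
      apply Real.exp_le_exp.mpr
      have h0 : 0 ≤ xlog (S.gk j) ^ (2 * 𝔠.lane.carrier.p₀) := Real.rpow_nonneg (le_trans zero_le_one (one_le_xlog (hg j hjK.le).1 (hg j hjK.le).2)) _
      have h1 : 0 ≤ c₁ * 𝔠.lane.carrier.b₀ ^ 2 / 8 := by positivity
      nlinarith [mul_nonneg h1 h0]
    calc _ ≤ Real.exp A₁ * Real.exp (-(c₁ * 𝔠.lane.carrier.b₀ ^ 2 / 8 * xlog (S.gk j) ^ (2 * 𝔠.lane.carrier.p₀))) * Real.exp (3 / ℓ * Sm) := h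
      _ ≤ Real.exp A₁ * Real.exp (-(c₁ * 𝔠.lane.carrier.b₀ ^ 2 / 8 / 2 * xlog (S.gk j) ^ (2 * 𝔠.lane.carrier.p₀))) * Real.exp (3 / ℓ * Sm) :=
          mul_le_mul_of_nonneg_right (mul_le_mul_of_nonneg_left hmono (Real.exp_pos _).le) (Real.exp_pos _).le
      _ = _ := by ring
  have hcollT : ∑ i ∈ Finset.range j, ∑ q ∈ (Finset.univ : Finset (Plaq (F.P K) i)).filter (fun q => ∃ c ∈ plaqCover q, ∃ y ∈ plaqCover a,
          sdist (j - 1) c y ≤ 2 * (rcolOf S 𝔠.lane.carrier i +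
            ((F.P K).L * ((F.P K).d * (𝔠.lane.carrier.M₁ - 1)) + (F.P K).d * ((F.P K).L - 1)) + (F.P K).d) + 1),
        ∑ r ∈ (Finset.univ : Finset (Hist (F.P K) K)).filter (fun r => ((i : ℕ), plaqCode q) ∈ Hist.disc r), f r ≤
      Real.exp A₁ * Real.exp (3 / ℓ * Sm) * (Ccoll / ℓ * Real.exp (-(c₁ * 𝔠.lane.carrier.b₀ ^ 2 / 8 / 2 * xlog (S.gk j) ^ (2 * 𝔠.lane.carrier.p₀)))) := by
    refine le_trans (Finset.sum_le_sum fun i hi => Finset.sum_le_sum fun q _ =>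
      hTle ((i : ℕ), plaqCode q) ((Hist.mem_disc _ _).2 ⟨⟨i, (Finset.mem_range.mp hi).trans hjK⟩, q, Finset.mem_univ _, rfl⟩)) ?_
    have hrew : ∀ i ∈ Finset.range j, ∑ q ∈ (Finset.univ : Finset (Plaq (F.P K) i)).filter (fun q => ∃ c ∈ plaqCover q, ∃ y ∈ plaqCover a,
          sdist (j - 1) c y ≤ 2 * (rcolOf S 𝔠.lane.carrier i +
            ((F.P K).L * ((F.P K).d * (𝔠.lane.carrier.M₁ - 1)) + (F.P K).d * ((F.P K).L - 1)) + (F.P K).d) + 1),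
        Real.exp A₁ * Real.exp (-(c₁ * 𝔠.lane.carrier.b₀ ^ 2 / 8 * xlog (S.gk i) ^ (2 * 𝔠.lane.carrier.p₀))) * Real.exp (3 / ℓ * Sm) =
        Real.exp A₁ * Real.exp (3 / ℓ * Sm) * ((((Finset.univ : Finset (Plaq (F.P K) i)).filter (fun q => ∃ c ∈ plaqCover q, ∃ y ∈ plaqCover a,
          sdist (j - 1) c y ≤ 2 * (rcolOf S 𝔠.lane.carrier i +
            ((F.P K).L * ((F.P K).d * (𝔠.lane.carrier.M₁ - 1)) + (F.P K).d * ((F.P K).L - 1)) + (F.P K).d) + 1)).card : ℝ) *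
          Real.exp (-(c₁ * 𝔠.lane.carrier.b₀ ^ 2 / 8 * xlog (S.gk i) ^ (2 * 𝔠.lane.carrier.p₀)))) := by
      intro i _
      rw [Finset.sum_const, nsmul_eq_mul]; ring
    rw [Finset.sum_congr rfl hrew, ← Finset.mul_sum]
    exact mul_le_mul_of_nonneg_left hcollar (by positivity)
  -- the rate in the stub's letter and the constant
  have hrate : c₁ * 𝔠.lane.carrier.b₀ ^ 2 / 8 / 2 * xlog (S.gk j) ^ (2 * 𝔠.lane.carrier.p₀) =
      c₁ / 16 * B10.pFun 𝔠.b₀ 𝔠.p₀ (Real.sqrt (γ * ((F.L : ℝ)⁻¹) ^ (K - j))) ^ 2 := by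
    rw [← T3Scales_gk_eq F γ hγ (hγ1.trans (sq_min_one_le _ 𝔠.gamma0_pos)) K j hjK.le]
    exact ((pFun_sq_eq (c₁ := c₁) (b₀ := 𝔠.lane.carrier.b₀) (p₀ := 𝔠.lane.carrier.p₀) (hg j hjK.le).1 (hg j hjK.le).2).2.2).symm
  have hexpCZ : Real.exp (A₁ + 3 / ℓ * Sm + Real.log (1 + Ccoll / ℓ)) = Real.exp A₁ * Real.exp (3 / ℓ * Sm) * (1 + Ccoll / ℓ) := by
    rw [Real.exp_add, Real.exp_add, Real.exp_log (by positivity)]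
  calc _ ≤ _ := hsplit
    _ ≤ Real.exp A₁ * Real.exp (3 / ℓ * Sm) * Real.exp (-(c₁ * 𝔠.lane.carrier.b₀ ^ 2 / 8 / 2 * xlog (S.gk j) ^ (2 * 𝔠.lane.carrier.p₀))) +
        Real.exp A₁ * Real.exp (3 / ℓ * Sm) * (Ccoll / ℓ * Real.exp (-(c₁ * 𝔠.lane.carrier.b₀ ^ 2 / 8 / 2 * xlog (S.gk j) ^ (2 * 𝔠.lane.carrier.p₀)))) :=
        add_le_add hpin hcollT
    _ = Real.exp (A₁ + 3 / ℓ * Sm + Real.log (1 + Ccoll / ℓ)) * Real.exp (-(c₁ / 16 *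
        B10.pFun 𝔠.b₀ 𝔠.p₀ (Real.sqrt (γ * ((F.L : ℝ)⁻¹) ^ (K - j))) ^ 2)) := by rw [hexpCZ, ← hrate]; ring


/-! ## §2 The (S-ii) row of record from hJ -/

open Classical in
/-- ★★★ **THE ORGAN ROW (S-ii) `hSii` OF R-19936-S (✓p750864 `UV3PinnedStepKnitOfPackage.pinnedTop_of_pinnedLF`'s binder, VERBATIM) FROM THE DISPLAYED ROW hJ.**  Per family `F`,
record `𝔠`, socket `h : Of F 𝔠`, coupling `γ` in the window and depth `m`: IF (hJ) there is `A₁` such that for every run `K` and every ADMISSIBLE NON-TRIVIAL history `r` the lane's mass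
`m_K(r, ·)` of the package's data is `≤ e^{A₁}` `dV_K`-a.e. — the top-level a.e. MASS ENVELOPE of the K-fold transported history masses of `blockAvg ℰp` (print: `≤ 1` by Haar
compatibility; tree: the k-fold Jacobian row, lit GAPS G-B10-10(c), OPEN) — THEN `hSii` holds with `CZ := A₁ + (6∕log L)(2L^m)³ + log(1 + C_coll∕ℓ)`, `c := 1∕(64N)`, `A := 0`
(§1 `pinnedLF_le_of_massEnvelope` `dV_K`-a.e., the finitely many envelopes gathered by `ae_all_iff`).  With ✓p750864 and ✓p749772: `stub_pinnedStep` ⟸ v1 socket + `hMain` + hJ.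
[cite: Balaban1985UV3, (41) p.266, (67)–(71) p.273, pp.273–274, (7) p.257] -/
theorem _root_.Summit.QuantumFields.YangMills.Theorems.AlphaInputsT3AC.Of.hSii_of_massEnvelope (h : AlphaInputsT3AC.Of F 𝔠)
    (γ : ℝ) (hγ : 0 < γ) (hγ1 : γ ≤ (min 𝔠.gamma0 1) ^ 2) (m : ℕ)
    (hJ : ∃ A₁ : ℝ, ∀ (K : ℕ) (r : Hist (F.P K) K),
      Hist.Admissible 𝔠.lane.carrier.M₁ (rcolOf (T3Scales F γ hγ (hγ1.trans (sq_min_one_le _ 𝔠.gamma0_pos)) K) 𝔠.lane.carrier) K r →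
      r ≠ Hist.triv (F.P K) K →
      ∀ᵐ W ∂(fieldMeasure (F.P K) K (Matrix.specialUnitaryGroup (Fin 2) ℂ)),
        (inputOfAC 𝔠.lane (h.pkgAt γ hγ hγ1 K).X (h.pkgAt γ hγ hγ1 K).𝔖).W.mass K r W ≤ Real.exp A₁) :
    ∃ (CZ c : ℝ) (A : ℕ), 0 < c ∧
      ∀ (K j : ℕ) (hj1 : 1 ≤ j) (hjK : j + 2 ≤ K), j + (K - 1) / m ≤ K → ∀ (a : Plaq (F.P K) j),
        ∀ᵐ W ∂(fieldMeasure (F.P K) K (Matrix.specialUnitaryGroup (Fin 2) ℂ)),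
        ∑ r ∈ Finset.univ.filter (fun r : Hist (F.P K) K =>
            a ∈ r ⟨j, by omega⟩ ∨ ¬ plaqCover a ⊆ Omega 𝔠.lane.carrier.M₁
              (rcolOf (T3Scales F γ hγ (hγ1.trans (sq_min_one_le _ 𝔠.gamma0_pos)) K) 𝔠.lane.carrier) j
              (fun i : Fin j => r (Fin.castLE (by omega) i)) j),
          (inputOfAC 𝔠.lane (h.pkgAt γ hγ hγ1 K).X (h.pkgAt γ hγ hγ1 K).𝔖).W.mass K r W *
            Real.exp (-((h.pkgAt γ hγ hγ1 K).T.mainT K r W) + (h.pkgAt γ hγ hγ1 K).T.Zterm K r) ≤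
        Real.exp CZ * ((F.scheme ℰp γ).β (K - j) ^ A *
          Real.exp (-(c * B10.pFun 𝔠.b₀ 𝔠.p₀ (Real.sqrt (γ * ((F.L : ℝ)⁻¹) ^ (K - j))) ^ 2))) := by
  obtain ⟨A₁, hA⟩ := hJ
  have hNpos : (0 : ℝ) < ((suGroupModel 2).N : ℝ) := by exact_mod_cast (suGroupModel 2).N_pos
  refine ⟨A₁ + 3 / (Real.log F.L / 2) * (2 * (F.L : ℝ) ^ F.m) ^ 3 +
      Real.log (1 + 9 * (2 * (2 * ((𝔠.lane.carrier.R₁ + 1) * 𝔠.lane.carrier.M₁) +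
        2 * ((F.L : ℝ) * (3 * ((𝔠.lane.carrier.M₁ : ℝ) - 1)) + 3 * ((F.L : ℝ) - 1)) + 15 * F.L + 7) + 6) ^ 3 / (Real.log F.L / 2)),
    1 / (4 * ((suGroupModel 2).N : ℝ)) / 16, 0, by positivity, fun K j hj1 hjK _ a => ?_⟩
  -- gather the finitely many a.e. envelopes of run `K`
  have hae : ∀ᵐ W ∂(fieldMeasure (F.P K) K (Matrix.specialUnitaryGroup (Fin 2) ℂ)), ∀ r : Hist (F.P K) K,
      Hist.Admissible 𝔠.lane.carrier.M₁ (rcolOf (T3Scales F γ hγ (hγ1.trans (sq_min_one_le _ 𝔠.gamma0_pos)) K) 𝔠.lane.carrier) K r →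
      r ≠ Hist.triv (F.P K) K → (inputOfAC 𝔠.lane (h.pkgAt γ hγ hγ1 K).X (h.pkgAt γ hγ hγ1 K).𝔖).W.mass K r W ≤ Real.exp A₁ := by
    refine ae_all_iff.2 fun r => ?_
    by_cases hadm : Hist.Admissible 𝔠.lane.carrier.M₁
      (rcolOf (T3Scales F γ hγ (hγ1.trans (sq_min_one_le _ 𝔠.gamma0_pos)) K) 𝔠.lane.carrier) K r
    · by_cases hne : r = Hist.triv (F.P K) K
      · exact Filter.Eventually.of_forall fun W _ h2 => absurd hne h2
      · filter_upwards [hA K r hadm hne] with W hW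
        exact fun _ _ => hW
    · exact Filter.Eventually.of_forall fun W h1 _ => absurd h1 hadm
  filter_upwards [hae] with W hW
  rw [pow_zero, one_mul]
  exact pinnedLF_le_of_massEnvelope (h.pkgAt γ hγ hγ1 K) (by omega) a W hW

end Summit.QuantumFields.YangMills.Theorems.UV3PinnedStepOrganOfMassEnvelope

end
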